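import Summits.QuantumFields.YangMills.Theorems.LuscherReductionOneSiteLevelsValleyFar

/-!
# VALLEY, step 4a: Gaussian toolkit for the NEAR (Laplace) estimate — shift, oddness, second moments, tail, gain
# (support module for `stub_absUpperValleyMag` of crux `OneSiteLevels`, route `LuscherReduction`, item stmt-QuantumFields-20007;
# fleet lead prover ym-luscher-20007-p1 g2)

Generic estimates on `E = EuclideanSpace ℝ ι` (`n = |ι|`), used in the gnomonic chart `ℝ⁹` of `SU(2)³` at a point `U`:
`integral_gaussShift` (complete the square: `∫ e^{−b‖y‖² − ⟨g,y⟩} F(y) = e^{‖g‖²/(4b)} ∫ e^{−b‖z‖²} F(z − g/(2b))`),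
`integral_gauss_inner_odd`, `integral_gauss_quadForm(_shift)` (`∫ e^{−b‖z‖²} Σ_m⟨r_m, z − s⟩² = N(Λ/(2b) + Q(s))`, `Λ = Σ‖r_m‖²`,
`N = √(π/b)^n`), `integral_gauss_tail_le` (Chernoff: `∫ e^{−b‖z‖²}(A‖z‖² + C)1[‖z‖² > m] ≤ e^{−bm/2}(An/b + C)√(π/(b/2))^n`),
`exp_neg_le_one_sub_gain` (`e^{−x} ≤ 1 − (5/8)x·1[x ≤ ½]`, `x ≥ 0`), and THE GAIN LEMMA `integral_gaussGain_le`: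
`∫ e^{−b‖y‖²−⟨g,y⟩}(1 − (5/8)κQ(y)1[κQ(y) ≤ ½]) ≤ e^{‖g‖²/(4b)} N (1 − (5/16)X)`, `X = κΛ/(2b)`, provided `X‖g‖²/b ≤ ¼` and
`(√2)^n e^{−1/(32X)}(4n + ‖g‖²/b) ≤ ½` — the transverse Hessian of the one-site action becomes the gain of the VALLEY supersolution test.

## WHAT THIS IS NOT
Generic analysis; NOT the valley estimate, NOT the crux, NOT THE CLAY GAP.  Sorry-free; no new definition, no named fact.
-/

set_option autoImplicit false

noncomputable section

open MeasureTheory Filter Topology Real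
open scoped RealInnerProductSpace BigOperators

namespace Summit.QuantumFields.YangMills.Theorems.FemtoTransferGap.GaussNear

variable {ι : Type*} [Fintype ι]

/-- `e^{−x} ≤ 1 − x + ¾x²` for `0 ≤ x ≤ 1` (`Real.exp_bound`, `n = 2`). [folklore] -/
theorem exp_neg_le_taylor {x : ℝ} (hx0 : 0 ≤ x) (hx1 : x ≤ 1) : Real.exp (-x) ≤ 1 - x + 3 / 4 * x ^ 2 := by
  have hx : |(-x)| ≤ 1 := by rw [abs_neg, abs_of_nonneg hx0]; exact hx1
  have h := Real.exp_bound hx (n := 2) (by norm_num)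
  simp [Finset.sum_range_succ, Nat.factorial] at h
  norm_num at h
  have h' := (abs_le.1 h).2
  nlinarith [h']

/-- **Pointwise gain**: `e^{−x} ≤ 1 − (5/8)·x·1[x ≤ ½]` for `x ≥ 0`. [folklore] -/
theorem exp_neg_le_one_sub_gain {x : ℝ} (hx0 : 0 ≤ x) :
    Real.exp (-x) ≤ 1 - 5 / 8 * (if x ≤ 1 / 2 then x else 0) := by
  split_ifs with h
  · have := exp_neg_le_taylor hx0 (by linarith)
    nlinarith
  · rw [mul_zero, sub_zero, Real.exp_le_one_iff]; linarith

/-- **Gaussian shift**: `∫ e^{−b‖y‖² − ⟨g,y⟩} F(y) dy = e^{‖g‖²/(4b)} ∫ e^{−b‖z‖²} F(z − (2b)⁻¹g) dz` (`b ≠ 0`; translation invariance of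
Lebesgue measure; no integrability needed). [folklore] -/
theorem integral_gaussShift {b : ℝ} (hb : b ≠ 0) (g : EuclideanSpace ℝ ι) (F : EuclideanSpace ℝ ι → ℝ) :
    ∫ y, Real.exp (-b * ‖y‖ ^ 2 - ⟪g, y⟫) * F y
      = Real.exp (‖g‖ ^ 2 / (4 * b)) * ∫ z, Real.exp (-b * ‖z‖ ^ 2) * F (z - (2 * b)⁻¹ • g) := by
  set s : EuclideanSpace ℝ ι := (2 * b)⁻¹ • g with hs
  rw [← integral_const_mul]
  have h := integral_add_right_eq_self (μ := (volume : Measure (EuclideanSpace ℝ ι)))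
    (fun z => Real.exp (‖g‖ ^ 2 / (4 * b)) * (Real.exp (-b * ‖z‖ ^ 2) * F (z - s))) s
  rw [← h]
  refine integral_congr_ae (ae_of_all _ fun y => ?_)
  simp only [add_sub_cancel_right]
  rw [← mul_assoc, ← Real.exp_add]
  congr 2
  have hn : ‖y + s‖ ^ 2 = ‖y‖ ^ 2 + 2 * ⟪y, s⟫ + ‖s‖ ^ 2 := norm_add_sq_real y s
  have hys : ⟪y, s⟫ = (2 * b)⁻¹ * ⟪g, y⟫ := by rw [hs, real_inner_smul_right, real_inner_comm]
  have hss : ‖s‖ ^ 2 = (2 * b)⁻¹ ^ 2 * ‖g‖ ^ 2 := by rw [hs, norm_smul, mul_pow, Real.norm_eq_abs, sq_abs]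
  rw [hn, hys, hss]
  field_simp
  ring

/-- **Oddness**: the first Gaussian moment `∫ e^{−b‖z‖²} ⟨r, z⟩ dz` vanishes. [folklore] -/
theorem integral_gauss_inner_odd (b : ℝ) (r : EuclideanSpace ℝ ι) :
    ∫ z : EuclideanSpace ℝ ι, Real.exp (-b * ‖z‖ ^ 2) * ⟪r, z⟫ = 0 := by
  have h := integral_neg_eq_self (fun z : EuclideanSpace ℝ ι => Real.exp (-b * ‖z‖ ^ 2) * ⟪r, z⟫) volume
  simp only [norm_neg, inner_neg_right, mul_neg] at h
  rw [integral_neg] at h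
  linarith

/-- **Second moment of a sum of squares of linear forms**: `∫ e^{−b‖z‖²} Σ_m ⟨r_m,z⟩² dz = (Σ_m ‖r_m‖²) √(π/b)^n/(2b)`. [folklore] -/
theorem integral_gauss_quadForm {b : ℝ} (hb : 0 < b) {M : Type*} [Fintype M] (r : M → EuclideanSpace ℝ ι) :
    ∫ z : EuclideanSpace ℝ ι, Real.exp (-b * ‖z‖ ^ 2) * ∑ m, ⟪r m, z⟫ ^ 2
      = (∑ m, ‖r m‖ ^ 2) * Real.sqrt (π / b) ^ Fintype.card ι / (2 * b) := by
  simp_rw [Finset.mul_sum]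
  rw [integral_finsetSum _ fun m _ => ?_]
  · simp_rw [show ∀ m (z : EuclideanSpace ℝ ι), Real.exp (-b * ‖z‖ ^ 2) * ⟪r m, z⟫ ^ 2 = ⟪r m, z⟫ ^ 2 * Real.exp (-b * ‖z‖ ^ 2)
      from fun m z => mul_comm _ _, GaussForm.integral_inner_sq_mul_exp_neg_mul_sq_norm hb, Finset.sum_mul, Finset.sum_div]
  · have h := GaussForm.integrable_inner_sq_mul_gauss hb (r m)
    exact h.congr (ae_of_all _ fun z => by ring)

/-- **Shifted second moment**: `∫ e^{−b‖z‖²} Σ_m ⟨r_m, z − s⟩² dz = N·((Σ‖r_m‖²)/(2b) + Σ_m⟨r_m,s⟩²)`, `N = √(π/b)^n`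
(cross terms are odd). [folklore] -/
theorem integral_gauss_quadForm_shift {b : ℝ} (hb : 0 < b) {M : Type*} [Fintype M] (r : M → EuclideanSpace ℝ ι) (s : EuclideanSpace ℝ ι) :
    ∫ z : EuclideanSpace ℝ ι, Real.exp (-b * ‖z‖ ^ 2) * ∑ m, ⟪r m, z - s⟫ ^ 2
      = Real.sqrt (π / b) ^ Fintype.card ι * ((∑ m, ‖r m‖ ^ 2) / (2 * b) + ∑ m, ⟪r m, s⟫ ^ 2) := by
  have hN := GaussForm.integral_exp_neg_mul_sq_norm (ι := ι) hb
  -- expand the square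
  have e : ∀ z : EuclideanSpace ℝ ι, Real.exp (-b * ‖z‖ ^ 2) * ∑ m, ⟪r m, z - s⟫ ^ 2
      = Real.exp (-b * ‖z‖ ^ 2) * ∑ m, ⟪r m, z⟫ ^ 2
        + (∑ m, (-2 * ⟪r m, s⟫) * (Real.exp (-b * ‖z‖ ^ 2) * ⟪r m, z⟫))
        + (∑ m, ⟪r m, s⟫ ^ 2) * Real.exp (-b * ‖z‖ ^ 2) := by
    intro z
    simp_rw [inner_sub_right]
    rw [Finset.mul_sum, Finset.mul_sum, Finset.sum_mul, ← Finset.sum_add_distrib, ← Finset.sum_add_distrib]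
    exact Finset.sum_congr rfl fun m _ => by ring
  simp_rw [e]
  have i1 : Integrable (fun z : EuclideanSpace ℝ ι => Real.exp (-b * ‖z‖ ^ 2) * ∑ m, ⟪r m, z⟫ ^ 2) := by
    simp_rw [Finset.mul_sum]
    exact integrable_finsetSum _ fun m _ => (GaussForm.integrable_inner_sq_mul_gauss hb (r m)).congr (ae_of_all _ fun z => by ring)
  have i2m : ∀ m, Integrable (fun z : EuclideanSpace ℝ ι => Real.exp (-b * ‖z‖ ^ 2) * ⟪r m, z⟫) := by
    intro m
    -- `|⟨r,z⟩| e^{-b‖z‖²} ≤ (⟨r,z⟩² + 1) e^{-b‖z‖²}`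
    have hdom : Integrable (fun z : EuclideanSpace ℝ ι => ⟪r m, z⟫ ^ 2 * Real.exp (-b * ‖z‖ ^ 2) + Real.exp (-b * ‖z‖ ^ 2)) :=
      (GaussForm.integrable_inner_sq_mul_gauss hb (r m)).add (GaussForm.integrable_gauss hb)
    refine hdom.mono'
      ((by fun_prop : Continuous fun z : EuclideanSpace ℝ ι => Real.exp (-b * ‖z‖ ^ 2) * ⟪r m, z⟫).aestronglyMeasurable)
      (ae_of_all _ fun z => ?_)
    rw [Real.norm_eq_abs, abs_mul, abs_of_pos (Real.exp_pos _)]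
    have h0 := Real.exp_pos (-b * ‖z‖ ^ 2)
    nlinarith [sq_nonneg (|⟪r m, z⟫| - 1), sq_abs ⟪r m, z⟫, abs_nonneg ⟪r m, z⟫]
  have i2 : Integrable (fun z : EuclideanSpace ℝ ι => ∑ m, (-2 * ⟪r m, s⟫) * (Real.exp (-b * ‖z‖ ^ 2) * ⟪r m, z⟫)) :=
    integrable_finsetSum _ fun m _ => (i2m m).const_mul _
  have i3 : Integrable (fun z : EuclideanSpace ℝ ι => (∑ m, ⟪r m, s⟫ ^ 2) * Real.exp (-b * ‖z‖ ^ 2)) :=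
    (GaussForm.integrable_gauss hb).const_mul _
  have i12 : Integrable (fun z : EuclideanSpace ℝ ι => Real.exp (-b * ‖z‖ ^ 2) * ∑ m, ⟪r m, z⟫ ^ 2
      + ∑ m, (-2 * ⟪r m, s⟫) * (Real.exp (-b * ‖z‖ ^ 2) * ⟪r m, z⟫)) := i1.add i2
  rw [integral_add i12 i3, integral_add i1 i2, integral_gauss_quadForm hb r,
    integral_finsetSum _ fun m _ => (i2m m).const_mul _]
  simp_rw [integral_const_mul, integral_gauss_inner_odd, mul_zero, Finset.sum_const_zero, add_zero]
  rw [hN]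
  ring

/-- **Gaussian tail by Chernoff**: for `A, C ≥ 0`, `m ≥ 0`, `b > 0`:
`∫ e^{−b‖z‖²}(A‖z‖² + C)·1[‖z‖² > m] dz ≤ e^{−bm/2} (A n/b + C) √(π/(b/2))^n`. [folklore] -/
theorem integral_gauss_tail_le [DecidableEq ι] {b A C m : ℝ} (hb : 0 < b) (hA : 0 ≤ A) (hC : 0 ≤ C) :
    ∫ z : EuclideanSpace ℝ ι, Real.exp (-b * ‖z‖ ^ 2) * ((A * ‖z‖ ^ 2 + C) * if m < ‖z‖ ^ 2 then 1 else 0)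
      ≤ Real.exp (-(b * m / 2)) * (A * (Fintype.card ι / b) + C) * Real.sqrt (π / (b / 2)) ^ Fintype.card ι := by
  have hb2 : 0 < b / 2 := by positivity
  -- pointwise Chernoff bound
  have hpt : ∀ z : EuclideanSpace ℝ ι, Real.exp (-b * ‖z‖ ^ 2) * ((A * ‖z‖ ^ 2 + C) * if m < ‖z‖ ^ 2 then 1 else 0)
      ≤ Real.exp (-(b * m / 2)) * ((A * ‖z‖ ^ 2 + C) * Real.exp (-(b / 2) * ‖z‖ ^ 2)) := by
    intro z
    have hAC : 0 ≤ A * ‖z‖ ^ 2 + C := by positivity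
    split_ifs with h
    · rw [mul_one]
      have : Real.exp (-b * ‖z‖ ^ 2) ≤ Real.exp (-(b * m / 2)) * Real.exp (-(b / 2) * ‖z‖ ^ 2) := by
        rw [← Real.exp_add]; exact Real.exp_le_exp.2 (by nlinarith)
      nlinarith [Real.exp_pos (-b * ‖z‖ ^ 2)]
    · rw [mul_zero, mul_zero]; positivity
  have hint1 : Integrable (fun z : EuclideanSpace ℝ ι =>
      Real.exp (-(b * m / 2)) * ((A * ‖z‖ ^ 2 + C) * Real.exp (-(b / 2) * ‖z‖ ^ 2))) := by
    have h := ((GaussForm.integrable_normSq_mul_gauss (ι := ι) hb2).const_mul A).add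
      ((GaussForm.integrable_gauss (ι := ι) hb2).const_mul C)
    refine (h.const_mul (Real.exp (-(b * m / 2)))).congr (ae_of_all _ fun z => ?_)
    simp only [Pi.add_apply]
    ring
  have hint0 : Integrable (fun z : EuclideanSpace ℝ ι =>
      Real.exp (-b * ‖z‖ ^ 2) * ((A * ‖z‖ ^ 2 + C) * if m < ‖z‖ ^ 2 then 1 else 0)) := by
    refine hint1.mono' ?_ (ae_of_all _ fun z => ?_)
    · refine (((by fun_prop : Continuous fun z : EuclideanSpace ℝ ι => Real.exp (-b * ‖z‖ ^ 2)).measurable).mul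
        (((by fun_prop : Continuous fun z : EuclideanSpace ℝ ι => A * ‖z‖ ^ 2 + C).measurable).mul
          (Measurable.ite ?_ measurable_const measurable_const))).aestronglyMeasurable
      exact measurableSet_lt measurable_const ((continuous_norm.pow 2).measurable)
    · rw [Real.norm_eq_abs, abs_of_nonneg]
      · exact hpt z
      · have : 0 ≤ (if m < ‖z‖ ^ 2 then (1:ℝ) else 0) := by split_ifs <;> norm_num
        positivity
  refine (integral_mono hint0 hint1 hpt).trans (le_of_eq ?_)
  rw [integral_const_mul]
  have e : ∫ z : EuclideanSpace ℝ ι, (A * ‖z‖ ^ 2 + C) * Real.exp (-(b / 2) * ‖z‖ ^ 2)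
      = A * (Fintype.card ι * (Real.sqrt (π / (b / 2)) ^ Fintype.card ι / (2 * (b / 2))))
        + C * Real.sqrt (π / (b / 2)) ^ Fintype.card ι := by
    have h1 := integral_norm_sq_mul_exp_neg_mul_sq_norm (ι := ι) hb2
    have h2 := GaussForm.integral_exp_neg_mul_sq_norm (ι := ι) hb2
    rw [← h1, ← h2, ← integral_const_mul, ← integral_const_mul,
      ← integral_add ((GaussForm.integrable_normSq_mul_gauss hb2).const_mul A) ((GaussForm.integrable_gauss hb2).const_mul C)]
    exact integral_congr_ae (ae_of_all _ fun z => by ring)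
  rw [e]
  field_simp

/-- `⟨r, z − s⟩² ≤ 2⟨r,z⟩² + 2⟨r,s⟩²`, summed: `Q(z − s) ≤ 2Q(z) + 2Q(s)`, and `Q(z) ≤ Λ‖z‖²`. [folklore] -/
theorem quadForm_sub_le {M : Type*} [Fintype M] (r : M → EuclideanSpace ℝ ι) (z s : EuclideanSpace ℝ ι) :
    ∑ m, ⟪r m, z - s⟫ ^ 2 ≤ 2 * ((∑ m, ‖r m‖ ^ 2) * ‖z‖ ^ 2) + 2 * ∑ m, ⟪r m, s⟫ ^ 2 := by
  have h1 : ∑ m, ⟪r m, z - s⟫ ^ 2 ≤ ∑ m, (2 * ⟪r m, z⟫ ^ 2 + 2 * ⟪r m, s⟫ ^ 2) :=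
    Finset.sum_le_sum fun m _ => by rw [inner_sub_right]; nlinarith [sq_nonneg (⟪r m, z⟫ + ⟪r m, s⟫)]
  have h2 : ∑ m, ⟪r m, z⟫ ^ 2 ≤ (∑ m, ‖r m‖ ^ 2) * ‖z‖ ^ 2 := by
    rw [Finset.sum_mul]
    exact Finset.sum_le_sum fun m _ => by
      have := abs_real_inner_le_norm (r m) z
      rw [← sq_abs]; exact (pow_le_pow_left₀ (abs_nonneg _) this 2).trans_eq (by ring)
  rw [Finset.sum_add_distrib, ← Finset.mul_sum, ← Finset.mul_sum] at h1
  linarith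

/-- Pointwise truncation bookkeeping: `κq − κB₀·1[P] ≤ κq·1[κq ≤ ½]` when `0 ≤ q ≤ B₀` and `κq > ½ ⇒ P`. [folklore] -/
theorem trunc_lower {κ q B₀ : ℝ} (hκ : 0 ≤ κ) (hq : 0 ≤ q) (hqB : q ≤ B₀) (P : Prop) [Decidable P]
    (hP : ¬ (κ * q ≤ 1 / 2) → P) :
    κ * q - κ * (B₀ * if P then 1 else 0) ≤ (if κ * q ≤ 1 / 2 then κ * q else 0) := by
  by_cases h : κ * q ≤ 1 / 2
  · rw [if_pos h]
    have : 0 ≤ κ * (B₀ * if P then 1 else 0) := by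
      have hB : 0 ≤ B₀ := hq.trans hqB
      have : 0 ≤ (if P then (1:ℝ) else 0) := by split_ifs <;> norm_num
      positivity
    linarith
  · rw [if_neg h, if_pos (hP h), mul_one]
    nlinarith

/-- **Lower bound for the truncated shifted quadratic moment.**  With `Q = Σ_m⟨r_m,·⟩²`, `Λ = Σ‖r_m‖²`, `κ > 0`, `b > 0`, a shift `s₀`
with `2κQ(s₀) ≤ ¼`, and `m₀ = 1/(8κΛ)`:
`∫ e^{−b‖z‖²} κQ(z−s₀)1[κQ(z−s₀) ≤ ½] dz ≥ κN(Λ/(2b) + Q(s₀)) − κ e^{−bm₀/2}(2Λn/b + 2Q(s₀))√(π/(b/2))^n`. [folklore] -/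
theorem integral_truncQuad_ge [DecidableEq ι] {b κ : ℝ} (hb : 0 < b) (hκ : 0 < κ) {M : Type*} [Fintype M]
    (r : M → EuclideanSpace ℝ ι) (s₀ : EuclideanSpace ℝ ι) (hΛ : 0 < ∑ m, ‖r m‖ ^ 2)
    (hsQ : 2 * κ * ∑ m, ⟪r m, s₀⟫ ^ 2 ≤ 1 / 4) :
    κ * (Real.sqrt (π / b) ^ Fintype.card ι * ((∑ m, ‖r m‖ ^ 2) / (2 * b) + ∑ m, ⟪r m, s₀⟫ ^ 2))
      - κ * (Real.exp (-(b * (1 / (8 * κ * ∑ m, ‖r m‖ ^ 2)) / 2))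
        * (2 * (∑ m, ‖r m‖ ^ 2) * (Fintype.card ι / b) + 2 * ∑ m, ⟪r m, s₀⟫ ^ 2) * Real.sqrt (π / (b / 2)) ^ Fintype.card ι)
      ≤ ∫ z : EuclideanSpace ℝ ι, Real.exp (-b * ‖z‖ ^ 2) *
          (if κ * ∑ m, ⟪r m, z - s₀⟫ ^ 2 ≤ 1 / 2 then κ * ∑ m, ⟪r m, z - s₀⟫ ^ 2 else 0) := by
  set Λ : ℝ := ∑ m, ‖r m‖ ^ 2 with hΛdef
  set Qs : ℝ := ∑ m, ⟪r m, s₀⟫ ^ 2 with hQs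
  set m₀ : ℝ := 1 / (8 * κ * Λ) with hm₀
  have hQs0 : 0 ≤ Qs := Finset.sum_nonneg fun m _ => sq_nonneg _
  have hκΛ : 0 < κ * Λ := mul_pos hκ hΛ
  have hcont_gauss : Continuous fun z : EuclideanSpace ℝ ι => Real.exp (-b * ‖z‖ ^ 2) := by fun_prop
  have hQcont : Continuous fun z : EuclideanSpace ℝ ι => ∑ m, ⟪r m, z - s₀⟫ ^ 2 :=
    continuous_finsetSum _ fun m _ => (continuous_const.inner (continuous_id.sub continuous_const)).pow 2
  -- pointwise lower bound
  have hpt : ∀ z : EuclideanSpace ℝ ι,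
      κ * (Real.exp (-b * ‖z‖ ^ 2) * ∑ m, ⟪r m, z - s₀⟫ ^ 2)
        - κ * (Real.exp (-b * ‖z‖ ^ 2) * ((2 * Λ * ‖z‖ ^ 2 + 2 * Qs) * if m₀ < ‖z‖ ^ 2 then 1 else 0))
      ≤ Real.exp (-b * ‖z‖ ^ 2) * (if κ * ∑ m, ⟪r m, z - s₀⟫ ^ 2 ≤ 1 / 2 then κ * ∑ m, ⟪r m, z - s₀⟫ ^ 2 else 0) := by
    intro z
    have hq0 : 0 ≤ ∑ m, ⟪r m, z - s₀⟫ ^ 2 := Finset.sum_nonneg fun m _ => sq_nonneg _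
    have hqB : ∑ m, ⟪r m, z - s₀⟫ ^ 2 ≤ 2 * Λ * ‖z‖ ^ 2 + 2 * Qs := by
      have := quadForm_sub_le r z s₀; rw [← hΛdef, ← hQs] at this; linarith
    have hP : ¬ (κ * ∑ m, ⟪r m, z - s₀⟫ ^ 2 ≤ 1 / 2) → m₀ < ‖z‖ ^ 2 := by
      intro h
      push Not at h
      by_contra hz
      push Not at hz
      have h1 : κ * ∑ m, ⟪r m, z - s₀⟫ ^ 2 ≤ κ * (2 * Λ * ‖z‖ ^ 2 + 2 * Qs) := mul_le_mul_of_nonneg_left hqB hκ.le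
      have h2 : κ * (2 * Λ * ‖z‖ ^ 2) ≤ κ * (2 * Λ * m₀) := by
        refine mul_le_mul_of_nonneg_left (mul_le_mul_of_nonneg_left hz (by positivity)) hκ.le
      have h3 : κ * (2 * Λ * m₀) = 1 / 4 := by rw [hm₀]; field_simp; ring
      nlinarith
    have h := trunc_lower hκ.le hq0 hqB (m₀ < ‖z‖ ^ 2) hP
    have hE := Real.exp_pos (-b * ‖z‖ ^ 2)
    have := mul_le_mul_of_nonneg_left h hE.le
    linarith [this]
  -- integrability
  have hintQs : Integrable (fun z : EuclideanSpace ℝ ι => Real.exp (-b * ‖z‖ ^ 2) * ∑ m, ⟪r m, z - s₀⟫ ^ 2) := by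
    have hdom : Integrable (fun z : EuclideanSpace ℝ ι => 2 * Λ * (‖z‖ ^ 2 * Real.exp (-b * ‖z‖ ^ 2))
        + 2 * Qs * Real.exp (-b * ‖z‖ ^ 2)) :=
      ((GaussForm.integrable_normSq_mul_gauss hb).const_mul _).add ((GaussForm.integrable_gauss hb).const_mul _)
    refine hdom.mono' (hcont_gauss.mul hQcont).aestronglyMeasurable (ae_of_all _ fun z => ?_)
    have hq0 : 0 ≤ ∑ m, ⟪r m, z - s₀⟫ ^ 2 := Finset.sum_nonneg fun m _ => sq_nonneg _
    rw [Real.norm_eq_abs, abs_mul, abs_of_pos (Real.exp_pos _), abs_of_nonneg hq0]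
    have h := quadForm_sub_le r z s₀
    rw [← hΛdef, ← hQs] at h
    have h0 := Real.exp_pos (-b * ‖z‖ ^ 2)
    nlinarith
  have hint_tail : Integrable (fun z : EuclideanSpace ℝ ι =>
      Real.exp (-b * ‖z‖ ^ 2) * ((2 * Λ * ‖z‖ ^ 2 + 2 * Qs) * if m₀ < ‖z‖ ^ 2 then 1 else 0)) := by
    have hdom : Integrable (fun z : EuclideanSpace ℝ ι => 2 * Λ * (‖z‖ ^ 2 * Real.exp (-b * ‖z‖ ^ 2))
        + 2 * Qs * Real.exp (-b * ‖z‖ ^ 2)) :=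
      ((GaussForm.integrable_normSq_mul_gauss hb).const_mul _).add ((GaussForm.integrable_gauss hb).const_mul _)
    refine hdom.mono' ?_ (ae_of_all _ fun z => ?_)
    · refine (hcont_gauss.measurable.mul (((by fun_prop : Continuous fun z : EuclideanSpace ℝ ι =>
        2 * Λ * ‖z‖ ^ 2 + 2 * Qs).measurable).mul (Measurable.ite ?_ measurable_const measurable_const))).aestronglyMeasurable
      exact measurableSet_lt measurable_const ((continuous_norm.pow 2).measurable)
    · have hind : 0 ≤ (if m₀ < ‖z‖ ^ 2 then (1:ℝ) else 0) ∧ (if m₀ < ‖z‖ ^ 2 then (1:ℝ) else 0) ≤ 1 := by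
        split_ifs <;> norm_num
      have h0 := Real.exp_pos (-b * ‖z‖ ^ 2)
      have hB0 : 0 ≤ 2 * Λ * ‖z‖ ^ 2 + 2 * Qs := by positivity
      rw [Real.norm_eq_abs, abs_of_nonneg (mul_nonneg h0.le (mul_nonneg hB0 hind.1))]
      nlinarith [mul_le_mul_of_nonneg_left hind.2 hB0]
  have hintι : Integrable (fun z : EuclideanSpace ℝ ι => Real.exp (-b * ‖z‖ ^ 2) *
      (if κ * ∑ m, ⟪r m, z - s₀⟫ ^ 2 ≤ 1 / 2 then κ * ∑ m, ⟪r m, z - s₀⟫ ^ 2 else 0)) := by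
    refine (hintQs.const_mul κ).mono' ?_ (ae_of_all _ fun z => ?_)
    · refine (hcont_gauss.measurable.mul (Measurable.ite ?_ (measurable_const.mul hQcont.measurable) measurable_const)).aestronglyMeasurable
      exact measurableSet_le (continuous_const.mul hQcont).measurable measurable_const
    · have hq0 : 0 ≤ ∑ m, ⟪r m, z - s₀⟫ ^ 2 := Finset.sum_nonneg fun m _ => sq_nonneg _
      have hi0 : 0 ≤ (if κ * ∑ m, ⟪r m, z - s₀⟫ ^ 2 ≤ 1 / 2 then κ * ∑ m, ⟪r m, z - s₀⟫ ^ 2 else 0) := by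
        split_ifs <;> [exact mul_nonneg hκ.le hq0; exact le_rfl]
      have hile : (if κ * ∑ m, ⟪r m, z - s₀⟫ ^ 2 ≤ 1 / 2 then κ * ∑ m, ⟪r m, z - s₀⟫ ^ 2 else 0) ≤ κ * ∑ m, ⟪r m, z - s₀⟫ ^ 2 := by
        split_ifs <;> [exact le_rfl; exact mul_nonneg hκ.le hq0]
      rw [Real.norm_eq_abs, abs_mul, abs_of_pos (Real.exp_pos _), abs_of_nonneg hi0]
      have h0 := Real.exp_pos (-b * ‖z‖ ^ 2)
      nlinarith
  have hlowint : Integrable (fun z : EuclideanSpace ℝ ι =>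
      κ * (Real.exp (-b * ‖z‖ ^ 2) * ∑ m, ⟪r m, z - s₀⟫ ^ 2)
        - κ * (Real.exp (-b * ‖z‖ ^ 2) * ((2 * Λ * ‖z‖ ^ 2 + 2 * Qs) * if m₀ < ‖z‖ ^ 2 then 1 else 0))) :=
    (hintQs.const_mul κ).sub (hint_tail.const_mul κ)
  have hmono := integral_mono hlowint hintι hpt
  rw [integral_sub (hintQs.const_mul κ) (hint_tail.const_mul κ), integral_const_mul, integral_const_mul] at hmono
  have hmain : ∫ z : EuclideanSpace ℝ ι, Real.exp (-b * ‖z‖ ^ 2) * ∑ m, ⟪r m, z - s₀⟫ ^ 2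
      = Real.sqrt (π / b) ^ Fintype.card ι * (Λ / (2 * b) + Qs) := by
    rw [hΛdef, hQs]; exact integral_gauss_quadForm_shift hb r s₀
  have htail := integral_gauss_tail_le (ι := ι) (m := m₀) hb (by positivity : (0:ℝ) ≤ 2 * Λ) (by positivity : (0:ℝ) ≤ 2 * Qs)
  rw [hmain] at hmono
  have := mul_le_mul_of_nonneg_left htail hκ.le
  linarith

/-- **THE GAIN LEMMA.**  Let `b > 0`, `κ > 0`, `Q = Σ_m ⟨r_m,·⟩²` with `Λ = Σ‖r_m‖² > 0`, `X = κΛ/(2b)`, and `g ∈ E`.  If `X‖g‖²/b ≤ ¼` and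
the Chernoff junk `(√2)^n e^{−1/(32X)} (4n + ‖g‖²/b) ≤ ½`, then
`∫ e^{−b‖y‖²−⟨g,y⟩}(1 − (5/8)·κQ(y)·1[κQ(y) ≤ ½]) dy ≤ e^{‖g‖²/(4b)} √(π/b)^n (1 − (5/16) X)`. [folklore] -/
theorem integral_gaussGain_le [DecidableEq ι] {b κ : ℝ} (hb : 0 < b) (hκ : 0 < κ) {M : Type*} [Fintype M]
    (r : M → EuclideanSpace ℝ ι) (g : EuclideanSpace ℝ ι) (hΛ : 0 < ∑ m, ‖r m‖ ^ 2)
    (hsmall : κ * (∑ m, ‖r m‖ ^ 2) / (2 * b) * (‖g‖ ^ 2 / b) ≤ 1 / 4)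
    (hjunk : Real.sqrt 2 ^ Fintype.card ι * Real.exp (-(1 / (32 * (κ * (∑ m, ‖r m‖ ^ 2) / (2 * b)))))
      * (4 * Fintype.card ι + ‖g‖ ^ 2 / b) ≤ 1 / 2) :
    ∫ y, Real.exp (-b * ‖y‖ ^ 2 - ⟪g, y⟫) *
        (1 - 5 / 8 * (if κ * ∑ m, ⟪r m, y⟫ ^ 2 ≤ 1 / 2 then κ * ∑ m, ⟪r m, y⟫ ^ 2 else 0))
      ≤ Real.exp (‖g‖ ^ 2 / (4 * b)) * Real.sqrt (π / b) ^ Fintype.card ι * (1 - 5 / 16 * (κ * (∑ m, ‖r m‖ ^ 2) / (2 * b))) := by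
  set Λ : ℝ := ∑ m, ‖r m‖ ^ 2 with hΛdef
  set X : ℝ := κ * Λ / (2 * b) with hX
  set N : ℝ := Real.sqrt (π / b) ^ Fintype.card ι with hNdef
  set s₀ : EuclideanSpace ℝ ι := (2 * b)⁻¹ • g with hs₀
  have hX0 : 0 < X := by rw [hX]; positivity
  have hN0 : 0 < N := by rw [hNdef]; positivity
  -- shift
  have hshift := integral_gaussShift hb.ne' g
    (fun y => 1 - 5 / 8 * (if κ * ∑ m, ⟪r m, y⟫ ^ 2 ≤ 1 / 2 then κ * ∑ m, ⟪r m, y⟫ ^ 2 else 0))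
  rw [hshift, ← hs₀]
  -- `Q(s₀) ≤ Λ‖s₀‖²`, `‖s₀‖² = ‖g‖²/(4b²)` ⇒ `2κQ(s₀) ≤ X‖g‖²/b ≤ ¼`
  set Qs : ℝ := ∑ m, ⟪r m, s₀⟫ ^ 2 with hQs
  have hQs0 : 0 ≤ Qs := Finset.sum_nonneg fun m _ => sq_nonneg _
  have hκQs : 2 * κ * Qs ≤ X * (‖g‖ ^ 2 / b) := by
    have h1 : Qs ≤ Λ * ‖s₀‖ ^ 2 := by
      rw [hQs, hΛdef, Finset.sum_mul]
      exact Finset.sum_le_sum fun m _ => by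
        have := abs_real_inner_le_norm (r m) s₀
        rw [← sq_abs]; exact (pow_le_pow_left₀ (abs_nonneg _) this 2).trans_eq (by ring)
    have h2 : ‖s₀‖ ^ 2 = ‖g‖ ^ 2 / (4 * b ^ 2) := by
      rw [hs₀, norm_smul, mul_pow, Real.norm_eq_abs, sq_abs]; field_simp; ring
    have h3 : 2 * κ * (Λ * ‖s₀‖ ^ 2) = X * (‖g‖ ^ 2 / b) := by rw [h2, hX]; field_simp; ring
    nlinarith [mul_le_mul_of_nonneg_left h1 (by positivity : (0:ℝ) ≤ 2 * κ)]
  have hsQ : 2 * κ * Qs ≤ 1 / 4 := hκQs.trans hsmall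
  -- the truncated moment lower bound
  have hlow := integral_truncQuad_ge hb hκ r s₀ hΛ hsQ
  rw [← hΛdef, ← hQs, ← hNdef] at hlow
  -- numerics
  have hexp : Real.exp (-(b * (1 / (8 * κ * Λ)) / 2)) = Real.exp (-(1 / (32 * X))) := by
    congr 1; rw [hX]; field_simp; ring
  have hsqrt : Real.sqrt (π / (b / 2)) ^ Fintype.card ι = Real.sqrt 2 ^ Fintype.card ι * N := by
    rw [hNdef, ← mul_pow, ← Real.sqrt_mul (by norm_num : (0:ℝ) ≤ 2)]
    congr 2; field_simp
  rw [hexp, hsqrt] at hlow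
  have hjunk' : κ * (Real.exp (-(1 / (32 * X))) * (2 * Λ * (Fintype.card ι / b) + 2 * Qs) * (Real.sqrt 2 ^ Fintype.card ι * N))
      ≤ N * X / 2 := by
    have e1 : κ * (2 * Λ * (Fintype.card ι / b)) = 4 * Fintype.card ι * X := by rw [hX]; field_simp; ring
    have h1 : κ * (2 * Λ * (Fintype.card ι / b) + 2 * Qs) ≤ X * (4 * Fintype.card ι + ‖g‖ ^ 2 / b) := by nlinarith [hκQs, e1]
    calc κ * (Real.exp (-(1 / (32 * X))) * (2 * Λ * (Fintype.card ι / b) + 2 * Qs) * (Real.sqrt 2 ^ Fintype.card ι * N))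
        = (Real.exp (-(1 / (32 * X))) * Real.sqrt 2 ^ Fintype.card ι * N) * (κ * (2 * Λ * (Fintype.card ι / b) + 2 * Qs)) := by ring
      _ ≤ (Real.exp (-(1 / (32 * X))) * Real.sqrt 2 ^ Fintype.card ι * N) * (X * (4 * Fintype.card ι + ‖g‖ ^ 2 / b)) :=
          mul_le_mul_of_nonneg_left h1 (by positivity)
      _ = N * X * (Real.sqrt 2 ^ Fintype.card ι * Real.exp (-(1 / (32 * X))) * (4 * Fintype.card ι + ‖g‖ ^ 2 / b)) := by ring
      _ ≤ N * X * (1 / 2) := mul_le_mul_of_nonneg_left hjunk (by positivity)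
      _ = N * X / 2 := by ring
  have hfirst : N * X ≤ κ * (N * (Λ / (2 * b) + Qs)) := by
    have e : κ * (N * (Λ / (2 * b) + Qs)) = N * X + κ * N * Qs := by rw [hX]; ring
    have : 0 ≤ κ * N * Qs := by positivity
    linarith
  have hιint : N * X / 2 ≤ ∫ z : EuclideanSpace ℝ ι, Real.exp (-b * ‖z‖ ^ 2) *
      (if κ * ∑ m, ⟪r m, z - s₀⟫ ^ 2 ≤ 1 / 2 then κ * ∑ m, ⟪r m, z - s₀⟫ ^ 2 else 0) := by linarith
  -- integrability of the truncated term (bounded by `κ e^{-b|z|²} Q(z−s₀)`), then split the integral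
  have hcont_gauss : Continuous fun z : EuclideanSpace ℝ ι => Real.exp (-b * ‖z‖ ^ 2) := by fun_prop
  have hQcont : Continuous fun z : EuclideanSpace ℝ ι => ∑ m, ⟪r m, z - s₀⟫ ^ 2 :=
    continuous_finsetSum _ fun m _ => (continuous_const.inner (continuous_id.sub continuous_const)).pow 2
  have hintι : Integrable (fun z : EuclideanSpace ℝ ι => Real.exp (-b * ‖z‖ ^ 2) *
      (if κ * ∑ m, ⟪r m, z - s₀⟫ ^ 2 ≤ 1 / 2 then κ * ∑ m, ⟪r m, z - s₀⟫ ^ 2 else 0)) := by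
    refine ((GaussForm.integrable_gauss hb).const_mul (1 / 2)).mono' ?_ (ae_of_all _ fun z => ?_)
    · refine (hcont_gauss.measurable.mul (Measurable.ite ?_ (measurable_const.mul hQcont.measurable) measurable_const)).aestronglyMeasurable
      exact measurableSet_le (continuous_const.mul hQcont).measurable measurable_const
    · have hq0 : 0 ≤ ∑ m, ⟪r m, z - s₀⟫ ^ 2 := Finset.sum_nonneg fun m _ => sq_nonneg _
      have hi0 : 0 ≤ (if κ * ∑ m, ⟪r m, z - s₀⟫ ^ 2 ≤ 1 / 2 then κ * ∑ m, ⟪r m, z - s₀⟫ ^ 2 else 0) := by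
        split_ifs <;> [exact mul_nonneg hκ.le hq0; exact le_rfl]
      have hile : (if κ * ∑ m, ⟪r m, z - s₀⟫ ^ 2 ≤ 1 / 2 then κ * ∑ m, ⟪r m, z - s₀⟫ ^ 2 else 0) ≤ 1 / 2 := by
        split_ifs with h <;> [exact h; norm_num]
      rw [Real.norm_eq_abs, abs_mul, abs_of_pos (Real.exp_pos _), abs_of_nonneg hi0]
      have h0 := Real.exp_pos (-b * ‖z‖ ^ 2)
      nlinarith
  have hN : ∫ z : EuclideanSpace ℝ ι, Real.exp (-b * ‖z‖ ^ 2) = N := by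
    rw [hNdef]; exact GaussForm.integral_exp_neg_mul_sq_norm hb
  have esplit : ∫ z : EuclideanSpace ℝ ι, Real.exp (-b * ‖z‖ ^ 2) *
      (1 - 5 / 8 * (if κ * ∑ m, ⟪r m, z - s₀⟫ ^ 2 ≤ 1 / 2 then κ * ∑ m, ⟪r m, z - s₀⟫ ^ 2 else 0))
      = N - 5 / 8 * ∫ z : EuclideanSpace ℝ ι, Real.exp (-b * ‖z‖ ^ 2) *
          (if κ * ∑ m, ⟪r m, z - s₀⟫ ^ 2 ≤ 1 / 2 then κ * ∑ m, ⟪r m, z - s₀⟫ ^ 2 else 0) := by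
    rw [← hN, ← integral_const_mul, ← integral_sub (GaussForm.integrable_gauss hb) (hintι.const_mul _)]
    exact integral_congr_ae (ae_of_all _ fun z => by ring)
  rw [esplit]
  have hE := Real.exp_pos (‖g‖ ^ 2 / (4 * b))
  nlinarith [hιint, hE]

end Summit.QuantumFields.YangMills.Theorems.FemtoTransferGap.GaussNear

end
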